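import Literature.Barriers.RiemannHypothesis.GramRosserFailuresHolds
import HarnessLib

/-!
# Gram/Rosser failures, narrowed barrier — discharge of `GramRosserFailuresNarrow`

Discharge of the named barrier fact `Literature.Barriers.RiemannHypothesis.GramRosserFailuresNarrow`
(`GramRosserFailures.lean`): for every `C, T₀` there is `t ≥ T₀` with `N₀(t) < ϑ(t)/π − C` — the
single inequality "`N₀(t) ≥ ϑ(t)/π − C` on a ray is impossible" through which Titchmarsh 1935,
Lehman 1970 / Trudgian 2011 Thm. 7.3 and Edwards §8.4 all pass.  Its normal form
`¬ ∃ C T₀, ∀ t ≥ T₀, ϑ(t)/π − C ≤ N₀(t)` is the tree's theorem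
`Literature.Barriers.RiemannHypothesis.not_exists_criticalZeroCount_ge` (`GramRosserFailuresHolds.lean`:
Littlewood's `∫ S = O(log T)` leaves finitely many zeros off the line, then Landau 1911 /
Bohr–Landau makes `S` bounded below impossible); this file only pushes the negation inside.
(The module docstring of `GramRosserFailures.lean` refers to this file for `GramRosserFailuresNarrow_holds`.)

## References
* [TrudgianGram2011] T. S. Trudgian, *On the success and failure of Gram's Law and the Rosser
  Rule*, Acta Arith. 148 (2011), §4.3 (40) and Thm. 7.3.
* [Edwards1974] H. M. Edwards, *Riemann's Zeta Function* (1974), §8.4.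
-/

namespace Literature.Barriers.RiemannHypothesis

open Literature.NumberTheory.LFunctions

/-- **The narrowed Gram/Rosser barrier holds**: for every `C, T₀` some `t ≥ T₀` has
`N₀(t) < ϑ(t)/π − C` — the contrapositive reading of `not_exists_criticalZeroCount_ge`.
[cite: TrudgianGram2011, §4.3 (40) and Thm. 7.3 (proof)] [cite: Edwards1974, §8.4] -/
theorem GramRosserFailuresNarrow_holds : GramRosserFailuresNarrow := by
  intro C T₀
  by_contra h
  push Not at h
  exact not_exists_criticalZeroCount_ge ⟨C, T₀, fun t ht => h t ht⟩

end Literature.Barriers.RiemannHypothesis
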